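import Summits.CriticalPhenomena.PercolationContinuityZ3.Theorems.PercNearOneGluingAdditiveGluingGoodStepResidualIH
import Summits.CriticalPhenomena.PercolationContinuityZ3.Theorems.PercNearOneGluingAdditiveGluingBlockGoodDetachDriftFree
import HarnessLib

/-! # Crux `PercNearOneGluing.AdditiveGluing` (stmt-CriticalPhenomena-4576), stub `stub_goodStep` — the residual kernel with a SHARPER
# induction hypothesis and the DETACHED-DRIFT hypothesis (`goodStep_of_residualKernelCore`)

Invested seat `xfam-b` (cross-family direct attempt B on `residualKernel_two`); lands `--supports stmt-CriticalPhenomena-4576`; no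
definitions, no named facts.  Two further weakenings of the residual hypothesis of `goodStep_of_residualKernel`, at zero cost:

* `goodStep_of_residualKernelIHg`: as `goodStep_of_residualKernelIH`, but the induction hypothesis handed to the kernel now covers every
  weighting with at most as many positive-degree vertices as the GLUED weighting `u/S` (not just `u`): at the call site `u/S = K/S` still has
  fewer positive-degree vertices than `w` (`driftFree_card_lt`), and every graph the leaves need — `u`, `u − x`, `u/S`, the detached
  `u⁰⁰` and `u⁰⁰/S` — is dominated pairwise by `u/S`, hence covered (`posdeg_card_mono`).
* `goodStep_of_residualKernelCore`: in addition the kernel may assume DETACHED DRIFT — some relay is strictly better than `a₀` for the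
  glued two-point function of the weighting in which the block is detached from `a₀` at two block vertices — because the complementary
  case is the detached-drift-free leaf `blockGood_of_detachDriftFree` (this seat) fed with the induction hypothesis.  With `hdrift` already
  in the residue this leaves: bad block, `≥ 3` relays besides `b`, gluing drift AND detached gluing drift.  At `n = 6` these, together
  with the deletion-minimiser and one-deletion leaves, are escaped only on a thin sliver at the three-way relay tie (evidence note
  `XFAMB-residualKernelTwo-star.md`).
[cite: KozmaNitzan2024, §3.2 (Thms 4–5 pp. 12–14), §5.3 (Conjecture 6, p. 34), Question 7 (p. 36)]
-/

namespace Summit.CriticalPhenomena.PercolationContinuityZ3.Theorems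

open MeasureTheory Set
open Literature.Probability.LatticeModels (prodBernoulli)
open Literature.Probability.Percolation (BondConfig openConn openConnIn openGraph openCluster pinW)
open scoped BigOperators

noncomputable section
open Classical

section ResidualCore

open Literature.Probability.LatticeModels Literature.Probability.Percolation

variable {n : ℕ}

/-- The number of positive-degree vertices is monotone in the weighting (pointwise order of the real weights). [folklore] -/
theorem posdeg_card_mono (w w' : Sym2 (Fin n) → unitInterval) (h : ∀ e, (w' e : ℝ) ≤ (w e : ℝ)) :
    (Finset.univ.filter (fun v : Fin n => ∃ z : Fin n, 0 < (w' s(z, v) : ℝ))).card ≤ (Finset.univ.filter (fun v : Fin n => ∃ z : Fin n, 0 < (w s(z, v) : ℝ))).card := by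
  refine Finset.card_le_card fun v hv => ?_
  simp only [Finset.mem_filter, Finset.mem_univ, true_and] at hv ⊢
  obtain ⟨z, hz⟩ := hv
  exact ⟨z, lt_of_lt_of_le hz (h _)⟩

/-- Pinning a pair closed only lowers weights. [folklore] -/
theorem coe_pinW_empty_le (v : Sym2 (Fin n) → unitInterval) (e₀ e : Sym2 (Fin n)) :
    ((pinW v (↑({e₀} : Finset (Sym2 (Fin n)))) ∅ e : unitInterval) : ℝ) ≤ (v e : ℝ) := by
  by_cases he : e ∈ (↑({e₀} : Finset (Sym2 (Fin n))) : Set (Sym2 (Fin n)))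
  · rw [pinW_apply_of_mem_of_not_mem v he (Set.notMem_empty e)]
    exact (v e).2.1
  · rw [pinW_apply_of_not_mem v ∅ he]

/-- **`stub_goodStep` from the residual kernel with the induction hypothesis up to the GLUED weighting.**  See the module docstring.
[cite: KozmaNitzan2024, §3.2 (Thms 4–5 pp. 12–14), §5.3 (Conjecture 6, p. 34)] -/
theorem goodStep_of_residualKernelIHg
    (hres : ∀ (n : ℕ) (u : Sym2 (Fin n) → unitInterval) (A S : Finset (Fin n)) (b a₀ : Fin n)
      (sel : Finset (Fin n) → Fin n),
      b ∈ A → Disjoint S A → 2 ≤ S.card → 4 ≤ A.card → (∀ W, sel W ∈ A) → a₀ ∈ A →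
      (∀ a ∈ A, (prodBernoulli u).real (openConn a₀ b) ≤ (prodBernoulli u).real (openConn a b)) →
      (∀ v ∈ S, (prodBernoulli u).real (openConn v b) < (prodBernoulli u).real (openConn a₀ b)) →
      (∃ a ∈ A, (prodBernoulli (fun e : Sym2 (Fin n) => if (∀ x ∈ e, x ∈ S) ∧ ¬ e.IsDiag then 1 else u e)).real (openConn a b) <
        (prodBernoulli (fun e : Sym2 (Fin n) => if (∀ x ∈ e, x ∈ S) ∧ ¬ e.IsDiag then 1 else u e)).real (openConn a₀ b)) →
      (∀ w' : Sym2 (Fin n) → unitInterval,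
        (Finset.univ.filter (fun v : Fin n => ∃ z : Fin n, 0 < (w' s(z, v) : ℝ))).card
          ≤ (Finset.univ.filter (fun v : Fin n => ∃ z : Fin n, 0 < ((fun e : Sym2 (Fin n) => if (∀ x ∈ e, x ∈ S) ∧ ¬ e.IsDiag then 1 else u e) s(z, v) : ℝ))).card →
        ∀ (A' : Finset (Fin n)) (o' b' : Fin n), b' ∈ A' → o' ∉ A' →
        ∀ (t : ℝ) (sel' : Finset (Fin n) → Fin n), (∀ W, sel' W ∈ A') →
          (∀ a ∈ A', 1 - t ≤ (prodBernoulli w').real (openConn a b')) →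
          (prodBernoulli w').real ((⋃ a ∈ A', openConn o' a) ∩ (openConn o' b')ᶜ)
            + ∑ W ∈ (Finset.univ : Finset (Finset (Fin n))).filter (fun W => o' ∈ W ∧ Disjoint W A'),
                (prodBernoulli w').real {ω : BondConfig (Fin n) | openCluster ω o' = (W : Set (Fin n))}
                  * (prodBernoulli w').real (openConnIn ((W : Set (Fin n))ᶜ) (sel' W) b')ᶜ
            ≤ t) →
      (prodBernoulli u).real (openConn a₀ b)
          + (prodBernoulli u).real ((openConn a₀ b)ᶜ ∩ (⋃ s ∈ S, openConn a₀ s) ∩ (⋃ s ∈ S, openConn s b))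
        ≤ (prodBernoulli u).real (⋃ s ∈ S, openConn s b)
          + ∑ W ∈ (Finset.univ : Finset (Finset (Fin n))).filter (fun W => Disjoint W A),
              (prodBernoulli u).real {ω : BondConfig (Fin n) | ∀ z : Fin n, (z ∈ W ↔ ω ∈ ⋃ s ∈ S, openConn s z)}
                * (prodBernoulli u).real (openConnIn ((W : Set (Fin n))ᶜ) (sel W) b)) :
    ∀ (n : ℕ) (w : Sym2 (Fin n) → unitInterval) (A : Finset (Fin n)) (o b : Fin n),
      b ∈ A → o ∉ A →
      (∃ y : Fin n, y ∉ A ∧ y ≠ o ∧ (w s(o, y) : ℝ) ≠ 0) →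
      (∀ w' : Sym2 (Fin n) → unitInterval,
        (Finset.univ.filter (fun v : Fin n => ∃ u : Fin n, 0 < (w' s(u, v) : ℝ))).card
          < (Finset.univ.filter (fun v : Fin n => ∃ u : Fin n, 0 < (w s(u, v) : ℝ))).card →
        ∀ (A' : Finset (Fin n)) (o' b' : Fin n), b' ∈ A' → o' ∉ A' →
        ∀ (t : ℝ) (sel : Finset (Fin n) → Fin n), (∀ W, sel W ∈ A') →
          (∀ a ∈ A', 1 - t ≤ (prodBernoulli w').real (openConn a b')) →
          (prodBernoulli w').real ((⋃ a ∈ A', openConn o' a) ∩ (openConn o' b')ᶜ)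
            + ∑ W ∈ (Finset.univ : Finset (Finset (Fin n))).filter (fun W => o' ∈ W ∧ Disjoint W A'),
                (prodBernoulli w').real {ω : BondConfig (Fin n) | openCluster ω o' = (W : Set (Fin n))}
                  * (prodBernoulli w').real (openConnIn ((W : Set (Fin n))ᶜ) (sel W) b')ᶜ
            ≤ t) →
      ∀ (t : ℝ) (sel : Finset (Fin n) → Fin n), (∀ W, sel W ∈ A) →
        (∀ a ∈ A, 1 - t ≤ (prodBernoulli w).real (openConn a b)) →
        (prodBernoulli w).real ((⋃ a ∈ A, openConn o a) ∩ (openConn o b)ᶜ)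
            + ∑ W ∈ (Finset.univ : Finset (Finset (Fin n))).filter (fun W => o ∈ W ∧ Disjoint W A),
                (prodBernoulli w).real {ω : BondConfig (Fin n) | openCluster ω o = (W : Set (Fin n))}
                  * (prodBernoulli w).real (openConnIn ((W : Set (Fin n))ᶜ) (sel W) b)ᶜ
          ≤ t := by
  intro n w A o b hb ho hlow IH
  obtain ⟨y₀, -, -, hy₀⟩ := id hlow
  refine goodStep24_main n w A o b hb ho hlow IH ?_
  intro S sel a₀ h2 hoS hSA hSw hsel ha₀ hmin hbad
  set K : Sym2 (Fin n) → unitInterval := fun e => if o ∈ e then (0 : unitInterval) else w e with hK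
  obtain ⟨s₀, hs₀⟩ := Finset.card_pos.1 (lt_of_lt_of_le zero_lt_two h2)
  have hs₀A : s₀ ∉ A := Finset.disjoint_left.1 hSA hs₀
  -- the induction hypothesis, for every weighting with at most as many positive-degree vertices as the GLUED `K/S`
  have hIHK : (∀ w' : Sym2 (Fin n) → unitInterval,
        (Finset.univ.filter (fun v : Fin n => ∃ z : Fin n, 0 < (w' s(z, v) : ℝ))).card
          ≤ (Finset.univ.filter (fun v : Fin n => ∃ z : Fin n, 0 < ((fun e : Sym2 (Fin n) => if (∀ x ∈ e, x ∈ S) ∧ ¬ e.IsDiag then 1 else K e) s(z, v) : ℝ))).card →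
        ∀ (A' : Finset (Fin n)) (o' b' : Fin n), b' ∈ A' → o' ∉ A' →
        ∀ (t : ℝ) (sel' : Finset (Fin n) → Fin n), (∀ W, sel' W ∈ A') →
          (∀ a ∈ A', 1 - t ≤ (prodBernoulli w').real (openConn a b')) →
          (prodBernoulli w').real ((⋃ a ∈ A', openConn o' a) ∩ (openConn o' b')ᶜ)
            + ∑ W ∈ (Finset.univ : Finset (Finset (Fin n))).filter (fun W => o' ∈ W ∧ Disjoint W A'),
                (prodBernoulli w').real {ω : BondConfig (Fin n) | openCluster ω o' = (W : Set (Fin n))}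
                  * (prodBernoulli w').real (openConnIn ((W : Set (Fin n))ᶜ) (sel' W) b')ᶜ
            ≤ t) :=
    fun w' hw' => IH w' (lt_of_le_of_lt hw' (driftFree_card_lt w S o y₀ hoS hy₀ hSw))
  -- the goal in un-glued form (H3)
  rw [blockGrowth_glue_real_openConn, blockGrowth_glue_real_iUnion K S b]
  simp only [blockGrowth_glue_real_pocket K S]
  by_cases hA3 : A.card ≤ 3
  · exact blockGood_cardLeThree K A S b a₀ (fun W' => sel (insert o W')) hb ha₀ hA3 ⟨s₀, hs₀⟩ (fun W' => hsel _) hmin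
  by_cases hfree : ∀ a ∈ A, (prodBernoulli (fun e : Sym2 (Fin n) =>
      if (∀ x ∈ e, x ∈ S) ∧ ¬ e.IsDiag then 1 else K e)).real (openConn a₀ b) ≤
    (prodBernoulli (fun e : Sym2 (Fin n) => if (∀ x ∈ e, x ∈ S) ∧ ¬ e.IsDiag then 1 else K e)).real (openConn a b)
  · have hgood := IH (fun e : Sym2 (Fin n) => if (∀ x ∈ e, x ∈ S) ∧ ¬ e.IsDiag then 1 else K e)
      (driftFree_card_lt w S o y₀ hoS hy₀ hSw) A s₀ b hb hs₀A
    exact blockGood_leaf_ih K A S b a₀ s₀ (fun W' => sel (insert o W')) hs₀ hb (fun W' => hsel _) hfree hgood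
  · push Not at hA3 hfree
    obtain ⟨a, ha, hlt⟩ := hfree
    exact hres n K A S b a₀ (fun W' => sel (insert o W')) hb hSA h2 (by omega) (fun W' => hsel _) ha₀ hmin hbad
      ⟨a, ha, hlt⟩ hIHK

/-- **`stub_goodStep` from the residual kernel restricted further to DETACHED DRIFT.**  The kernel may assume, besides everything in
`goodStep_of_residualKernelIHg`, two distinct block vertices `x, y ∈ S` and a relay strictly better than `a₀` for the glued two-point
function of the weighting with the pairs `x–a₀`, `y–a₀` killed; the complementary case is `blockGood_of_detachDriftFree` + IH.
See the module docstring. [cite: KozmaNitzan2024, §3.2 (Thms 4–5 pp. 12–14), Question 7 (p. 36)] -/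
theorem goodStep_of_residualKernelCore
    (hcore : ∀ (n : ℕ) (u : Sym2 (Fin n) → unitInterval) (A S : Finset (Fin n)) (b a₀ : Fin n)
      (sel : Finset (Fin n) → Fin n) (x y : Fin n),
      b ∈ A → Disjoint S A → 2 ≤ S.card → 4 ≤ A.card → (∀ W, sel W ∈ A) → a₀ ∈ A →
      (∀ a ∈ A, (prodBernoulli u).real (openConn a₀ b) ≤ (prodBernoulli u).real (openConn a b)) →
      (∀ v ∈ S, (prodBernoulli u).real (openConn v b) < (prodBernoulli u).real (openConn a₀ b)) →
      (∃ a ∈ A, (prodBernoulli (fun e : Sym2 (Fin n) => if (∀ x ∈ e, x ∈ S) ∧ ¬ e.IsDiag then 1 else u e)).real (openConn a b) <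
        (prodBernoulli (fun e : Sym2 (Fin n) => if (∀ x ∈ e, x ∈ S) ∧ ¬ e.IsDiag then 1 else u e)).real (openConn a₀ b)) →
      (∀ w' : Sym2 (Fin n) → unitInterval,
        (Finset.univ.filter (fun v : Fin n => ∃ z : Fin n, 0 < (w' s(z, v) : ℝ))).card
          ≤ (Finset.univ.filter (fun v : Fin n => ∃ z : Fin n, 0 < ((fun e : Sym2 (Fin n) => if (∀ x ∈ e, x ∈ S) ∧ ¬ e.IsDiag then 1 else u e) s(z, v) : ℝ))).card →
        ∀ (A' : Finset (Fin n)) (o' b' : Fin n), b' ∈ A' → o' ∉ A' →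
        ∀ (t : ℝ) (sel' : Finset (Fin n) → Fin n), (∀ W, sel' W ∈ A') →
          (∀ a ∈ A', 1 - t ≤ (prodBernoulli w').real (openConn a b')) →
          (prodBernoulli w').real ((⋃ a ∈ A', openConn o' a) ∩ (openConn o' b')ᶜ)
            + ∑ W ∈ (Finset.univ : Finset (Finset (Fin n))).filter (fun W => o' ∈ W ∧ Disjoint W A'),
                (prodBernoulli w').real {ω : BondConfig (Fin n) | openCluster ω o' = (W : Set (Fin n))}
                  * (prodBernoulli w').real (openConnIn ((W : Set (Fin n))ᶜ) (sel' W) b')ᶜ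
            ≤ t) →
      x ∈ S → y ∈ S → x ≠ y →
      (∃ a ∈ A, (prodBernoulli (fun e : Sym2 (Fin n) => if (∀ z ∈ e, z ∈ S) ∧ ¬ e.IsDiag then (1 : unitInterval) else (pinW (pinW u (↑({s(x, a₀)} : Finset (Sym2 (Fin n)))) ∅) (↑({s(y, a₀)} : Finset (Sym2 (Fin n)))) ∅) e)).real (openConn a b) < (prodBernoulli (fun e : Sym2 (Fin n) => if (∀ z ∈ e, z ∈ S) ∧ ¬ e.IsDiag then (1 : unitInterval) else (pinW (pinW u (↑({s(x, a₀)} : Finset (Sym2 (Fin n)))) ∅) (↑({s(y, a₀)} : Finset (Sym2 (Fin n)))) ∅) e)).real (openConn a₀ b)) →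
      (prodBernoulli u).real (openConn a₀ b)
          + (prodBernoulli u).real ((openConn a₀ b)ᶜ ∩ (⋃ s ∈ S, openConn a₀ s) ∩ (⋃ s ∈ S, openConn s b))
        ≤ (prodBernoulli u).real (⋃ s ∈ S, openConn s b)
          + ∑ W ∈ (Finset.univ : Finset (Finset (Fin n))).filter (fun W => Disjoint W A),
              (prodBernoulli u).real {ω : BondConfig (Fin n) | ∀ z : Fin n, (z ∈ W ↔ ω ∈ ⋃ s ∈ S, openConn s z)}
                * (prodBernoulli u).real (openConnIn ((W : Set (Fin n))ᶜ) (sel W) b)) :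
    ∀ (n : ℕ) (w : Sym2 (Fin n) → unitInterval) (A : Finset (Fin n)) (o b : Fin n),
      b ∈ A → o ∉ A →
      (∃ y : Fin n, y ∉ A ∧ y ≠ o ∧ (w s(o, y) : ℝ) ≠ 0) →
      (∀ w' : Sym2 (Fin n) → unitInterval,
        (Finset.univ.filter (fun v : Fin n => ∃ u : Fin n, 0 < (w' s(u, v) : ℝ))).card
          < (Finset.univ.filter (fun v : Fin n => ∃ u : Fin n, 0 < (w s(u, v) : ℝ))).card →
        ∀ (A' : Finset (Fin n)) (o' b' : Fin n), b' ∈ A' → o' ∉ A' →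
        ∀ (t : ℝ) (sel : Finset (Fin n) → Fin n), (∀ W, sel W ∈ A') →
          (∀ a ∈ A', 1 - t ≤ (prodBernoulli w').real (openConn a b')) →
          (prodBernoulli w').real ((⋃ a ∈ A', openConn o' a) ∩ (openConn o' b')ᶜ)
            + ∑ W ∈ (Finset.univ : Finset (Finset (Fin n))).filter (fun W => o' ∈ W ∧ Disjoint W A'),
                (prodBernoulli w').real {ω : BondConfig (Fin n) | openCluster ω o' = (W : Set (Fin n))}
                  * (prodBernoulli w').real (openConnIn ((W : Set (Fin n))ᶜ) (sel W) b')ᶜ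
            ≤ t) →
      ∀ (t : ℝ) (sel : Finset (Fin n) → Fin n), (∀ W, sel W ∈ A) →
        (∀ a ∈ A, 1 - t ≤ (prodBernoulli w).real (openConn a b)) →
        (prodBernoulli w).real ((⋃ a ∈ A, openConn o a) ∩ (openConn o b)ᶜ)
            + ∑ W ∈ (Finset.univ : Finset (Finset (Fin n))).filter (fun W => o ∈ W ∧ Disjoint W A),
                (prodBernoulli w).real {ω : BondConfig (Fin n) | openCluster ω o = (W : Set (Fin n))}
                  * (prodBernoulli w).real (openConnIn ((W : Set (Fin n))ᶜ) (sel W) b)ᶜ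
          ≤ t := by
  refine goodStep_of_residualKernelIHg ?_
  intro n u A S b a₀ sel hb hSA h2 h4 hsel ha₀ hmin hbad hdrift hIH
  -- two distinct block vertices
  obtain ⟨x, hx, y, hy, hxy⟩ := Finset.one_lt_card.1 (lt_of_lt_of_le one_lt_two h2)
  have hax : a₀ ≠ x := fun h => Finset.disjoint_left.1 hSA hx (h ▸ ha₀)
  have hay : a₀ ≠ y := fun h => Finset.disjoint_left.1 hSA hy (h ▸ ha₀)
  have hxA : x ∉ A := Finset.disjoint_left.1 hSA hx
  by_cases hddf : ∀ a ∈ A, (prodBernoulli (fun e : Sym2 (Fin n) => if (∀ z ∈ e, z ∈ S) ∧ ¬ e.IsDiag then (1 : unitInterval) else (pinW (pinW u (↑({s(x, a₀)} : Finset (Sym2 (Fin n)))) ∅) (↑({s(y, a₀)} : Finset (Sym2 (Fin n)))) ∅) e)).real (openConn a₀ b) ≤ (prodBernoulli (fun e : Sym2 (Fin n) => if (∀ z ∈ e, z ∈ S) ∧ ¬ e.IsDiag then (1 : unitInterval) else (pinW (pinW u (↑({s(x, a₀)} : Finset (Sym2 (Fin n)))) ∅) (↑({s(y, a₀)} : Finset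 (Sym2 (Fin n)))) ∅) e)).real (openConn a b)
  · -- no detached drift: the detached-drift-free leaf, fed with the induction hypothesis for `u⁰⁰/S`
    refine blockGood_of_detachDriftFree u A S b a₀ x y sel hx hy hb ha₀ hax hay hsel hddf ?_
    refine hIH (fun e : Sym2 (Fin n) => if (∀ z ∈ e, z ∈ S) ∧ ¬ e.IsDiag then (1 : unitInterval) else (pinW (pinW u (↑({s(x, a₀)} : Finset (Sym2 (Fin n)))) ∅) (↑({s(y, a₀)} : Finset (Sym2 (Fin n)))) ∅) e)
      (posdeg_card_mono (fun e : Sym2 (Fin n) => if (∀ x ∈ e, x ∈ S) ∧ ¬ e.IsDiag then 1 else u e) (fun e : Sym2 (Fin n) => if (∀ z ∈ e, z ∈ S) ∧ ¬ e.IsDiag then (1 : unitInterval) else (pinW (pinW u (↑({s(x, a₀)} : Finset (Sym2 (Fin n)))) ∅) (↑({s(y, a₀)} : Finset (Sym2 (Fin n)))) ∅) e) fun e => ?_) A x b hb hxA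
    show ((if (∀ z ∈ e, z ∈ S) ∧ ¬ e.IsDiag then (1 : unitInterval) else
        (pinW (pinW u (↑({s(x, a₀)} : Finset (Sym2 (Fin n)))) ∅) (↑({s(y, a₀)} : Finset (Sym2 (Fin n)))) ∅) e : unitInterval) : ℝ)
      ≤ ((if (∀ x ∈ e, x ∈ S) ∧ ¬ e.IsDiag then (1 : unitInterval) else u e : unitInterval) : ℝ)
    split_ifs
    · exact le_rfl
    · exact (coe_pinW_empty_le _ s(y, a₀) e).trans (coe_pinW_empty_le u s(x, a₀) e)
  · push Not at hddf
    obtain ⟨a, ha, hlt⟩ := hddf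
    exact hcore n u A S b a₀ sel x y hb hSA h2 h4 hsel ha₀ hmin hbad hdrift hIH hx hy hxy ⟨a, ha, hlt⟩

end ResidualCore

open Literature.Probability.LatticeModels Literature.Probability.Percolation in
/-- Registered helper stub `stub_goodStepOfResidualKernelCore_xb` (invested seat xfam-b): `stub_goodStep` ⟸ the residual kernel with the induction
hypothesis up to the glued weighting and restricted to DETACHED DRIFT (= `goodStep_of_residualKernelCore`).
[cite: KozmaNitzan2024, §3.2 (Thms 4–5 pp. 12–14), §5.3 (Conjecture 6, p. 34), Question 7 (p. 36)] -/
theorem stub_goodStepOfResidualKernelCore_xb : (∀ (n : ℕ) (u : Sym2 (Fin n) → unitInterval) (A S : Finset (Fin n)) (b a₀ : Fin n) (sel : Finset (Fin n) → Fin n) (x y : Fin n), b ∈ A → Disjoint S A → 2 ≤ S.card → 4 ≤ A.card → (∀ W, sel W ∈ A) → a₀ ∈ A → (∀ a ∈ A, (prodBernoulli u).real (openConn a₀ b) ≤ (prodBernoulli u).real (openConn a b)) → (∀ v ∈ S, (prodBernoulli u).real (openConn v b) < (prodBernoulli u).real (openConn a₀ b)) → (∃ a ∈ A, (prodBernoulli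 (fun e : Sym2 (Fin n) => if (∀ x ∈ e, x ∈ S) ∧ ¬ e.IsDiag then 1 else u e)).real (openConn a b) < (prodBernoulli (fun e : Sym2 (Fin n) => if (∀ x ∈ e, x ∈ S) ∧ ¬ e.IsDiag then 1 else u e)).real (openConn a₀ b)) → (∀ w' : Sym2 (Fin n) → unitInterval, (Finset.univ.filter (fun v : Fin n => ∃ z : Fin n, 0 < (w' s(z, v) : ℝ))).card ≤ (Finset.univ.filter (fun v : Fin n => ∃ z : Fin n, 0 < ((fun e : Sym2 (Fin n) => if (∀ x ∈ e, x ∈ S) ∧ ¬ e.IsDiag then 1 else u e) s(z, v) : ℝ))).card → ∀ (A' : Finset (Fin n)) (o' b' : Fin n), b' ∈ A' → o' ∉ A' → ∀ (t : ℝ) (sel' : Finset (Fin n) → Fin n), (∀ W, sel' W ∈ A') → (∀ a ∈ A', 1 - t ≤ (prodBernoulli w').real (openConn a b')) → (prodBernoulli w').real ((⋃ a ∈ A', openConn o' a) ∩ (openConn o' b')ᶜ) + ∑ W ∈ (Finset.univ : Finset (Finset (Fin n))).filter (fun W => o' ∈ W ∧ Disjoint W A'), (prodBernoulli w').real {ω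 : BondConfig (Fin n) | openCluster ω o' = (W : Set (Fin n))} * (prodBernoulli w').real (openConnIn ((W : Set (Fin n))ᶜ) (sel' W) b')ᶜ ≤ t) → x ∈ S → y ∈ S → x ≠ y → (∃ a ∈ A, (prodBernoulli (fun e : Sym2 (Fin n) => if (∀ z ∈ e, z ∈ S) ∧ ¬ e.IsDiag then (1 : unitInterval) else (pinW (pinW u (↑({s(x, a₀)} : Finset (Sym2 (Fin n)))) ∅) (↑({s(y, a₀)} : Finset (Sym2 (Fin n)))) ∅) e)).real (openConn a b) < (prodBernoulli (fun e : Sym2 (Fin n) => if (∀ z ∈ e, z ∈ S) ∧ ¬ e.IsDiag then (1 : unitInterval) else (pinW (pinW u (↑({s(x, a₀)} : Finset (Sym2 (Fin n)))) ∅) (↑({s(y, a₀)} : Finset (Sym2 (Fin n)))) ∅) e)).real (openConn a₀ b)) → (prodBernoulli u).real (openConn a₀ b) + (prodBernoulli u).real ((openConn a₀ b)ᶜ ∩ (⋃ s ∈ S, openConn a₀ s) ∩ (⋃ s ∈ S, openConn s b)) ≤ (prodBernoulli u).real (⋃ s ∈ S, openConn s b) + ∑ W ∈ (Finset.univ : Finset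 (Finset (Fin n))).filter (fun W => Disjoint W A), (prodBernoulli u).real {ω : BondConfig (Fin n) | ∀ z : Fin n, (z ∈ W ↔ ω ∈ ⋃ s ∈ S, openConn s z)} * (prodBernoulli u).real (openConnIn ((W : Set (Fin n))ᶜ) (sel W) b)) → ∀ (n : ℕ) (w : Sym2 (Fin n) → unitInterval) (A : Finset (Fin n)) (o b : Fin n), b ∈ A → o ∉ A → (∃ y : Fin n, y ∉ A ∧ y ≠ o ∧ (w s(o, y) : ℝ) ≠ 0) → (∀ w' : Sym2 (Fin n) → unitInterval, (Finset.univ.filter (fun v : Fin n => ∃ u : Fin n, 0 < (w' s(u, v) : ℝ))).card < (Finset.univ.filter (fun v : Fin n => ∃ u : Fin n, 0 < (w s(u, v) : ℝ))).card → ∀ (A' : Finset (Fin n)) (o' b' : Fin n), b' ∈ A' → o' ∉ A' → ∀ (t : ℝ) (sel : Finset (Fin n) → Fin n), (∀ W, sel W ∈ A') → (∀ a ∈ A', 1 - t ≤ (prodBernoulli w').real (openConn a b')) → (prodBernoulli w').real ((⋃ a ∈ A', openConn o' a) ∩ (openConn o' b')ᶜ) + ∑ W ∈ (Finset.univ : Finset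 (Finset (Fin n))).filter (fun W => o' ∈ W ∧ Disjoint W A'), (prodBernoulli w').real {ω : BondConfig (Fin n) | openCluster ω o' = (W : Set (Fin n))} * (prodBernoulli w').real (openConnIn ((W : Set (Fin n))ᶜ) (sel W) b')ᶜ ≤ t) → ∀ (t : ℝ) (sel : Finset (Fin n) → Fin n), (∀ W, sel W ∈ A) → (∀ a ∈ A, 1 - t ≤ (prodBernoulli w).real (openConn a b)) → (prodBernoulli w).real ((⋃ a ∈ A, openConn o a) ∩ (openConn o b)ᶜ) + ∑ W ∈ (Finset.univ : Finset (Finset (Fin n))).filter (fun W => o ∈ W ∧ Disjoint W A), (prodBernoulli w).real {ω : BondConfig (Fin n) | openCluster ω o = (W : Set (Fin n))} * (prodBernoulli w).real (openConnIn ((W : Set (Fin n))ᶜ) (sel W) b)ᶜ ≤ t :=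
  goodStep_of_residualKernelCore

end

end Summit.CriticalPhenomena.PercolationContinuityZ3.Theorems
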